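import Summits.HodgeConjecture.HodgeConjecture.Theorems.Ring2WeilCoverageCMFieldNormWitnesses
import HarnessLib

/-!
# Weil-type components over quartic CM fields, VII (part B): the census tables `n ≤ 40` as DECISION THEOREMS —
# `[n] = [1] ↔ n ∈ S_E` for `ℚ(√-3,√5)`, `ℚ(i,√5)`

research route conditional on HC_CM; not a corollary; Q11.4-sentence-2 already refuted in dim ≥ 3. Cell
`pub-hodge-ring2`, seat `ring2-b03` (gen 49); kernel form of the tables of the Weil-type family-coverage census
`HOME/WEIL-FAMILY-COVERAGE.md` §b03.5 («rational integers `n ≤ 40`: the COMPLETE list with `[n] = [1]`»), one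
theorem per field: for `E = ℚ[T]/(R(T²))` over `F = ℚ[S]/(R)` on Deligne's carriers
(`Deligne1982/WeilTypeCMDiscriminant`) and every `1 ≤ n ≤ 40`, the class `[n] ∈ F^×/Nm_{E/F}(E^×)`
(`cmNormResidueGroup R`) EQUALS the split class `[(-1)²]` (`splitDiscriminantClassCM R 2`; the component `W8.E.[n]`
of the census has an `E`-Lagrangian member, Deligne Cor. 4.2) IF AND ONLY IF `n` lies in the displayed finite set
`S_E`. Each of the 40 cases is ONE `exact`: a split entry by the integer-coordinate norm witness `(A + Bσ)² - σ(C +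
Dσ)² = n·m²` of part VI (`mk_eq_splitDiscriminantClassCM_two_of_coords_of_pos` of
`Ring2WeilCoverageCMFieldNormWitnesses`, applied inline with the witness `n A B C D m`; the prime entries are also
available there by name), a non-split entry by the certificate of gens 46–48 that decides it (local obstruction at
an inert / ramified / degree-one place; files `Ring2WeilCoverageCMField{Zeta5, NormDescent, NormDescentInstances,
Criteria, Biquadratic, InertPrimes, Ramified, SquareClasses, DegreeOnePrimes, DegreeOneCriteria, NonGalois}`). The
sets `S_E` agree with the census tables (PARI `rnfisnorm` + the disjoint stdlib code, ×2 by ring2-b06's third code,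
§b03.5 / §b06.1); this file makes the `n ≤ 40` index of every CM-field component table kernel-decided in both
directions. Companion tables: parts A (`ℚ(ζ₅)`, `ℚ(ζ₈)`, `ℚ(ζ₁₂)`) and C (`ℚ(√-(2+√2))`, `ℚ(√-(3+√2))`).

No named fact, no definition, no `sorry`; nothing about the Hodge conjecture is asserted (which row is the split one
is decided; the general member of every row, split or not, is OPEN — census §b03.2). References:
[Deligne1982HodgeCycles] §4 p. 30 (1), Cor. 4.2, Lemma 4.6; [Landherr1936HermitianForms]. -/

noncomputable section

set_option linter.dupNamespace false

open Polynomial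

namespace Summit.HodgeConjecture.HodgeConjecture.Ring2.WeilCoverageCM

open Literature.AlgebraicGeometry.Deligne1982
open Literature.AlgebraicGeometry.HodgeTheory (splitDiscriminantClassCM)

/-! ### §1 `E = ℚ(√-3,√5)`, `R = S² + 9S + 9`: `S_E` has 36 elements, 4 classes `n ≤ 40` are non-split -/

section SqrtNeg3Sqrt5

variable {R : Polynomial ℤ} (hR : R = X ^ 2 + C 9 * X + C 9) [Fact (Irreducible (realPolyQ R))]
include hR

/-- **DECISION TABLE for `E = ℚ(√-3,√5)` (`R = S² + 9S + 9`), `1 ≤ n ≤ 40`: `[n] = [1]` in `F^×/Nm_{E/F}(E^×)` — the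
component `W8.E.[n]` is the SPLIT one — iff `n ∉ {11, 22, 29, 33}`.** Split entries by integer norm witnesses;
non-split entries by the `ℓw` certificates at `ℓ = 11, 29` (`Ring2WeilCoverageCMFieldBiquadratic`). Agrees with
census §b03.5 (three independent computations). [cite: Deligne1982HodgeCycles, §4 p. 30 (1) and Cor. 4.2] -/
theorem sqrtNeg3Sqrt5_table (n : ℕ) (h1 : 1 ≤ n) (h40 : n ≤ 40) (u : (realField R)ˣ)
    (hu : (u : realField R) = n) :
    (QuotientGroup.mk u : cmNormResidueGroup R) = splitDiscriminantClassCM R 2 ↔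
      n ∉ ({11, 22, 29, 33} : Finset ℕ) := by
  interval_cases n
  · exact iff_of_true (mk_eq_splitDiscriminantClassCM_two_of_coords_of_pos hR (by norm_num) (by norm_num)
      disc_not_sq_nine_nine 1 1 0 0 0 1 one_ne_zero (by norm_num) (by norm_num) u (by rw [hu]; norm_num)) (by decide)
  · exact iff_of_true (mk_eq_splitDiscriminantClassCM_two_of_coords_of_pos hR (by norm_num) (by norm_num)
      disc_not_sq_nine_nine 2 0 1 9 1 6 (by norm_num) (by norm_num) (by norm_num) u (by rw [hu]; norm_num))
      (by decide)
  · exact iff_of_true (mk_eq_splitDiscriminantClassCM_two_of_coords_of_pos hR (by norm_num) (by norm_num)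
      disc_not_sq_nine_nine 3 0 0 6 1 3 three_ne_zero (by norm_num) (by norm_num) u (by rw [hu]; norm_num))
      (by decide)
  · exact iff_of_true (mk_eq_splitDiscriminantClassCM_two_of_coords_of_pos hR (by norm_num) (by norm_num)
      disc_not_sq_nine_nine 4 2 0 0 0 1 one_ne_zero (by norm_num) (by norm_num) u (by rw [hu]; norm_num)) (by decide)
  · exact iff_of_true (mk_eq_splitDiscriminantClassCM_two_of_coords_of_pos hR (by norm_num) (by norm_num)
      disc_not_sq_nine_nine 5 9 2 0 0 3 three_ne_zero (by norm_num) (by norm_num) u (by rw [hu]; norm_num))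
      (by decide)
  · exact iff_of_true (mk_eq_splitDiscriminantClassCM_two_of_coords_of_pos hR (by norm_num) (by norm_num)
      disc_not_sq_nine_nine 6 9 0 12 1 6 (by norm_num) (by norm_num) (by norm_num) u (by rw [hu]; norm_num))
      (by decide)
  · exact iff_of_true (mk_eq_splitDiscriminantClassCM_two_of_coords_of_pos hR (by norm_num) (by norm_num)
      disc_not_sq_nine_nine 7 1 0 6 1 2 two_ne_zero (by norm_num) (by norm_num) u (by rw [hu]; norm_num)) (by decide)
  · exact iff_of_true (mk_eq_splitDiscriminantClassCM_two_of_coords_of_pos hR (by norm_num) (by norm_num)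
      disc_not_sq_nine_nine 8 0 1 9 1 3 three_ne_zero (by norm_num) (by norm_num) u (by rw [hu]; norm_num))
      (by decide)
  · exact iff_of_true (mk_eq_splitDiscriminantClassCM_two_of_coords_of_pos hR (by norm_num) (by norm_num)
      disc_not_sq_nine_nine 9 3 0 0 0 1 one_ne_zero (by norm_num) (by norm_num) u (by rw [hu]; norm_num)) (by decide)
  · exact iff_of_true (mk_eq_splitDiscriminantClassCM_two_of_coords_of_pos hR (by norm_num) (by norm_num)
      disc_not_sq_nine_nine 10 2 1 7 1 2 two_ne_zero (by norm_num) (by norm_num) u (by rw [hu]; norm_num)) (by decide)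
  · exact iff_of_false (sqrtNeg3Sqrt5_mk_eleven_mul_ne_splitDiscriminantClassCM hR 1 (by norm_num) u
      (by rw [hu]; norm_num)) (by decide)
  · exact iff_of_true (mk_eq_splitDiscriminantClassCM_two_of_coords_of_pos hR (by norm_num) (by norm_num)
      disc_not_sq_nine_nine 12 9 0 6 1 3 three_ne_zero (by norm_num) (by norm_num) u (by rw [hu]; norm_num))
      (by decide)
  · exact iff_of_true (mk_eq_splitDiscriminantClassCM_two_of_coords_of_pos hR (by norm_num) (by norm_num)
      disc_not_sq_nine_nine 13 5 0 6 1 2 two_ne_zero (by norm_num) (by norm_num) u (by rw [hu]; norm_num)) (by decide)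
  · exact iff_of_true (mk_eq_splitDiscriminantClassCM_two_of_coords_of_pos hR (by norm_num) (by norm_num)
      disc_not_sq_nine_nine 14 18 1 15 1 6 (by norm_num) (by norm_num) (by norm_num) u (by rw [hu]; norm_num))
      (by decide)
  · exact iff_of_true (mk_eq_splitDiscriminantClassCM_two_of_coords_of_pos hR (by norm_num) (by norm_num)
      disc_not_sq_nine_nine 15 0 0 12 1 3 three_ne_zero (by norm_num) (by norm_num) u (by rw [hu]; norm_num))
      (by decide)
  · exact iff_of_true (mk_eq_splitDiscriminantClassCM_two_of_coords_of_pos hR (by norm_num) (by norm_num)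
      disc_not_sq_nine_nine 16 4 0 0 0 1 one_ne_zero (by norm_num) (by norm_num) u (by rw [hu]; norm_num)) (by decide)
  · exact iff_of_true (mk_eq_splitDiscriminantClassCM_two_of_coords_of_pos hR (by norm_num) (by norm_num)
      disc_not_sq_nine_nine 17 9 2 12 2 3 three_ne_zero (by norm_num) (by norm_num) u (by rw [hu]; norm_num))
      (by decide)
  · exact iff_of_true (mk_eq_splitDiscriminantClassCM_two_of_coords_of_pos hR (by norm_num) (by norm_num)
      disc_not_sq_nine_nine 18 0 1 9 1 2 two_ne_zero (by norm_num) (by norm_num) u (by rw [hu]; norm_num)) (by decide)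
  · exact iff_of_true (mk_eq_splitDiscriminantClassCM_two_of_coords_of_pos hR (by norm_num) (by norm_num)
      disc_not_sq_nine_nine 19 7 0 6 1 2 two_ne_zero (by norm_num) (by norm_num) u (by rw [hu]; norm_num)) (by decide)
  · exact iff_of_true (mk_eq_splitDiscriminantClassCM_two_of_coords_of_pos hR (by norm_num) (by norm_num)
      disc_not_sq_nine_nine 20 9 2 12 1 3 three_ne_zero (by norm_num) (by norm_num) u (by rw [hu]; norm_num))
      (by decide)
  · exact iff_of_true (mk_eq_splitDiscriminantClassCM_two_of_coords_of_pos hR (by norm_num) (by norm_num)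
      disc_not_sq_nine_nine 21 9 0 12 2 3 three_ne_zero (by norm_num) (by norm_num) u (by rw [hu]; norm_num))
      (by decide)
  · exact iff_of_false (sqrtNeg3Sqrt5_mk_eleven_mul_ne_splitDiscriminantClassCM hR 2 (by norm_num) u
      (by rw [hu]; norm_num)) (by decide)
  · exact iff_of_true (mk_eq_splitDiscriminantClassCM_two_of_coords_of_pos hR (by norm_num) (by norm_num)
      disc_not_sq_nine_nine 23 18 4 6 1 3 three_ne_zero (by norm_num) (by norm_num) u (by rw [hu]; norm_num))
      (by decide)
  · exact iff_of_true (mk_eq_splitDiscriminantClassCM_two_of_coords_of_pos hR (by norm_num) (by norm_num)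
      disc_not_sq_nine_nine 24 9 0 12 1 3 three_ne_zero (by norm_num) (by norm_num) u (by rw [hu]; norm_num))
      (by decide)
  · exact iff_of_true (mk_eq_splitDiscriminantClassCM_two_of_coords_of_pos hR (by norm_num) (by norm_num)
      disc_not_sq_nine_nine 25 5 0 0 0 1 one_ne_zero (by norm_num) (by norm_num) u (by rw [hu]; norm_num)) (by decide)
  · exact iff_of_true (mk_eq_splitDiscriminantClassCM_two_of_coords_of_pos hR (by norm_num) (by norm_num)
      disc_not_sq_nine_nine 26 27 2 18 1 6 (by norm_num) (by norm_num) (by norm_num) u (by rw [hu]; norm_num))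
      (by decide)
  · exact iff_of_true (mk_eq_splitDiscriminantClassCM_two_of_coords_of_pos hR (by norm_num) (by norm_num)
      disc_not_sq_nine_nine 27 0 0 6 1 1 one_ne_zero (by norm_num) (by norm_num) u (by rw [hu]; norm_num)) (by decide)
  · exact iff_of_true (mk_eq_splitDiscriminantClassCM_two_of_coords_of_pos hR (by norm_num) (by norm_num)
      disc_not_sq_nine_nine 28 1 0 6 1 1 one_ne_zero (by norm_num) (by norm_num) u (by rw [hu]; norm_num)) (by decide)
  · exact iff_of_false (sqrtNeg3Sqrt5_mk_twentyNine_mul_ne_splitDiscriminantClassCM hR 1 (by norm_num) u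
      (by rw [hu]; norm_num)) (by decide)
  · exact iff_of_true (mk_eq_splitDiscriminantClassCM_two_of_coords_of_pos hR (by norm_num) (by norm_num)
      disc_not_sq_nine_nine 30 27 6 30 5 6 (by norm_num) (by norm_num) (by norm_num) u (by rw [hu]; norm_num))
      (by decide)
  · exact iff_of_true (mk_eq_splitDiscriminantClassCM_two_of_coords_of_pos hR (by norm_num) (by norm_num)
      disc_not_sq_nine_nine 31 2 0 6 1 1 one_ne_zero (by norm_num) (by norm_num) u (by rw [hu]; norm_num)) (by decide)
  · exact iff_of_true (mk_eq_splitDiscriminantClassCM_two_of_coords_of_pos hR (by norm_num) (by norm_num)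
      disc_not_sq_nine_nine 32 9 (-1) 15 2 3 three_ne_zero (by norm_num) (by norm_num) u (by rw [hu]; norm_num))
      (by decide)
  · exact iff_of_false (sqrtNeg3Sqrt5_mk_eleven_mul_ne_splitDiscriminantClassCM hR 3 (by norm_num) u
      (by rw [hu]; norm_num)) (by decide)
  · exact iff_of_true (mk_eq_splitDiscriminantClassCM_two_of_coords_of_pos hR (by norm_num) (by norm_num)
      disc_not_sq_nine_nine 34 1 0 12 1 2 two_ne_zero (by norm_num) (by norm_num) u (by rw [hu]; norm_num))
      (by decide)
  · exact iff_of_true (mk_eq_splitDiscriminantClassCM_two_of_coords_of_pos hR (by norm_num) (by norm_num)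
      disc_not_sq_nine_nine 35 18 4 12 1 3 three_ne_zero (by norm_num) (by norm_num) u (by rw [hu]; norm_num))
      (by decide)
  · exact iff_of_true (mk_eq_splitDiscriminantClassCM_two_of_coords_of_pos hR (by norm_num) (by norm_num)
      disc_not_sq_nine_nine 36 6 0 0 0 1 one_ne_zero (by norm_num) (by norm_num) u (by rw [hu]; norm_num)) (by decide)
  · exact iff_of_true (mk_eq_splitDiscriminantClassCM_two_of_coords_of_pos hR (by norm_num) (by norm_num)
      disc_not_sq_nine_nine 37 11 0 6 1 2 two_ne_zero (by norm_num) (by norm_num) u (by rw [hu]; norm_num))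
      (by decide)
  · exact iff_of_true (mk_eq_splitDiscriminantClassCM_two_of_coords_of_pos hR (by norm_num) (by norm_num)
      disc_not_sq_nine_nine 38 27 1 27 2 6 (by norm_num) (by norm_num) (by norm_num) u (by rw [hu]; norm_num))
      (by decide)
  · exact iff_of_true (mk_eq_splitDiscriminantClassCM_two_of_coords_of_pos hR (by norm_num) (by norm_num)
      disc_not_sq_nine_nine 39 18 0 6 1 3 three_ne_zero (by norm_num) (by norm_num) u (by rw [hu]; norm_num))
      (by decide)
  · exact iff_of_true (mk_eq_splitDiscriminantClassCM_two_of_coords_of_pos hR (by norm_num) (by norm_num)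
      disc_not_sq_nine_nine 40 2 1 7 1 1 one_ne_zero (by norm_num) (by norm_num) u (by rw [hu]; norm_num)) (by decide)

end SqrtNeg3Sqrt5

/-! ### §2 `E = ℚ(i,√5)`, `R = S² + 3S + 1`: `S_E` has 34 elements, 6 classes `n ≤ 40` are non-split -/

section SqrtNeg1Sqrt5

variable {R : Polynomial ℤ} (hR : R = X ^ 2 + C 3 * X + C 1) [Fact (Irreducible (realPolyQ R))]
include hR

/-- **DECISION TABLE for `E = ℚ(i,√5)` (`R = S² + 3S + 1`), `1 ≤ n ≤ 40`: `[n] = [1]` in `F^×/Nm_{E/F}(E^×)` — the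
component `W8.E.[n]` is the SPLIT one — iff `n ∉ {11, 19, 22, 31, 33, 38}`.** Split entries by integer norm
witnesses; non-split entries by the `ℓw` certificates at `ℓ = 11, 19, 31` (`Ring2WeilCoverageCMFieldBiquadratic`).
Agrees with census §b03.5 (three independent computations).
[cite: Deligne1982HodgeCycles, §4 p. 30 (1) and Cor. 4.2] -/
theorem sqrtNeg1Sqrt5_table (n : ℕ) (h1 : 1 ≤ n) (h40 : n ≤ 40) (u : (realField R)ˣ)
    (hu : (u : realField R) = n) :
    (QuotientGroup.mk u : cmNormResidueGroup R) = splitDiscriminantClassCM R 2 ↔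
      n ∉ ({11, 19, 22, 31, 33, 38} : Finset ℕ) := by
  interval_cases n
  · exact iff_of_true (mk_eq_splitDiscriminantClassCM_two_of_coords_of_pos hR (by norm_num) (by norm_num)
      disc_not_sq_three_one 1 1 0 0 0 1 one_ne_zero (by norm_num) (by norm_num) u (by rw [hu]; norm_num)) (by decide)
  · exact iff_of_true (mk_eq_splitDiscriminantClassCM_two_of_coords_of_pos hR (by norm_num) (by norm_num)
      disc_not_sq_three_one 2 1 0 2 1 1 one_ne_zero (by norm_num) (by norm_num) u (by rw [hu]; norm_num)) (by decide)
  · exact iff_of_true (mk_eq_splitDiscriminantClassCM_two_of_coords_of_pos hR (by norm_num) (by norm_num)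
      disc_not_sq_three_one 3 2 1 1 0 1 one_ne_zero (by norm_num) (by norm_num) u (by rw [hu]; norm_num)) (by decide)
  · exact iff_of_true (mk_eq_splitDiscriminantClassCM_two_of_coords_of_pos hR (by norm_num) (by norm_num)
      disc_not_sq_three_one 4 2 0 0 0 1 one_ne_zero (by norm_num) (by norm_num) u (by rw [hu]; norm_num)) (by decide)
  · exact iff_of_true (mk_eq_splitDiscriminantClassCM_two_of_coords_of_pos hR (by norm_num) (by norm_num)
      disc_not_sq_three_one 5 2 0 2 1 1 one_ne_zero (by norm_num) (by norm_num) u (by rw [hu]; norm_num)) (by decide)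
  · exact iff_of_true (mk_eq_splitDiscriminantClassCM_two_of_coords_of_pos hR (by norm_num) (by norm_num)
      disc_not_sq_three_one 6 3 2 2 1 1 one_ne_zero (by norm_num) (by norm_num) u (by rw [hu]; norm_num)) (by decide)
  · exact iff_of_true (mk_eq_splitDiscriminantClassCM_two_of_coords_of_pos hR (by norm_num) (by norm_num)
      disc_not_sq_three_one 7 3 1 1 1 1 one_ne_zero (by norm_num) (by norm_num) u (by rw [hu]; norm_num)) (by decide)
  · exact iff_of_true (mk_eq_splitDiscriminantClassCM_two_of_coords_of_pos hR (by norm_num) (by norm_num)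
      disc_not_sq_three_one 8 2 0 4 2 1 one_ne_zero (by norm_num) (by norm_num) u (by rw [hu]; norm_num)) (by decide)
  · exact iff_of_true (mk_eq_splitDiscriminantClassCM_two_of_coords_of_pos hR (by norm_num) (by norm_num)
      disc_not_sq_three_one 9 3 0 0 0 1 one_ne_zero (by norm_num) (by norm_num) u (by rw [hu]; norm_num)) (by decide)
  · exact iff_of_true (mk_eq_splitDiscriminantClassCM_two_of_coords_of_pos hR (by norm_num) (by norm_num)
      disc_not_sq_three_one 10 3 0 2 1 1 one_ne_zero (by norm_num) (by norm_num) u (by rw [hu]; norm_num)) (by decide)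
  · exact iff_of_false (sqrtNeg1Sqrt5_mk_eleven_mul_ne_splitDiscriminantClassCM hR 1 (by norm_num) u
      (by rw [hu]; norm_num)) (by decide)
  · exact iff_of_true (mk_eq_splitDiscriminantClassCM_two_of_coords_of_pos hR (by norm_num) (by norm_num)
      disc_not_sq_three_one 12 4 2 2 0 1 one_ne_zero (by norm_num) (by norm_num) u (by rw [hu]; norm_num)) (by decide)
  · exact iff_of_true (mk_eq_splitDiscriminantClassCM_two_of_coords_of_pos hR (by norm_num) (by norm_num)
      disc_not_sq_three_one 13 3 0 4 2 1 one_ne_zero (by norm_num) (by norm_num) u (by rw [hu]; norm_num)) (by decide)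
  · exact iff_of_true (mk_eq_splitDiscriminantClassCM_two_of_coords_of_pos hR (by norm_num) (by norm_num)
      disc_not_sq_three_one 14 3 0 4 1 1 one_ne_zero (by norm_num) (by norm_num) u (by rw [hu]; norm_num)) (by decide)
  · exact iff_of_true (mk_eq_splitDiscriminantClassCM_two_of_coords_of_pos hR (by norm_num) (by norm_num)
      disc_not_sq_three_one 15 4 1 3 2 1 one_ne_zero (by norm_num) (by norm_num) u (by rw [hu]; norm_num)) (by decide)
  · exact iff_of_true (mk_eq_splitDiscriminantClassCM_two_of_coords_of_pos hR (by norm_num) (by norm_num)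
      disc_not_sq_three_one 16 4 0 0 0 1 one_ne_zero (by norm_num) (by norm_num) u (by rw [hu]; norm_num)) (by decide)
  · exact iff_of_true (mk_eq_splitDiscriminantClassCM_two_of_coords_of_pos hR (by norm_num) (by norm_num)
      disc_not_sq_three_one 17 4 0 2 1 1 one_ne_zero (by norm_num) (by norm_num) u (by rw [hu]; norm_num)) (by decide)
  · exact iff_of_true (mk_eq_splitDiscriminantClassCM_two_of_coords_of_pos hR (by norm_num) (by norm_num)
      disc_not_sq_three_one 18 5 2 0 1 1 one_ne_zero (by norm_num) (by norm_num) u (by rw [hu]; norm_num)) (by decide)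
  · exact iff_of_false (sqrtNeg1Sqrt5_mk_nineteen_mul_ne_splitDiscriminantClassCM hR 1 (by norm_num) u
      (by rw [hu]; norm_num)) (by decide)
  · exact iff_of_true (mk_eq_splitDiscriminantClassCM_two_of_coords_of_pos hR (by norm_num) (by norm_num)
      disc_not_sq_three_one 20 4 0 4 2 1 one_ne_zero (by norm_num) (by norm_num) u (by rw [hu]; norm_num)) (by decide)
  · exact iff_of_true (mk_eq_splitDiscriminantClassCM_two_of_coords_of_pos hR (by norm_num) (by norm_num)
      disc_not_sq_three_one 21 4 0 4 1 1 one_ne_zero (by norm_num) (by norm_num) u (by rw [hu]; norm_num)) (by decide)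
  · exact iff_of_false (sqrtNeg1Sqrt5_mk_eleven_mul_ne_splitDiscriminantClassCM hR 2 (by norm_num) u
      (by rw [hu]; norm_num)) (by decide)
  · exact iff_of_true (mk_eq_splitDiscriminantClassCM_two_of_coords_of_pos hR (by norm_num) (by norm_num)
      disc_not_sq_three_one 23 5 3 5 1 1 one_ne_zero (by norm_num) (by norm_num) u (by rw [hu]; norm_num)) (by decide)
  · exact iff_of_true (mk_eq_splitDiscriminantClassCM_two_of_coords_of_pos hR (by norm_num) (by norm_num)
      disc_not_sq_three_one 24 6 4 4 2 1 one_ne_zero (by norm_num) (by norm_num) u (by rw [hu]; norm_num)) (by decide)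
  · exact iff_of_true (mk_eq_splitDiscriminantClassCM_two_of_coords_of_pos hR (by norm_num) (by norm_num)
      disc_not_sq_three_one 25 5 0 0 0 1 one_ne_zero (by norm_num) (by norm_num) u (by rw [hu]; norm_num)) (by decide)
  · exact iff_of_true (mk_eq_splitDiscriminantClassCM_two_of_coords_of_pos hR (by norm_num) (by norm_num)
      disc_not_sq_three_one 26 5 0 2 1 1 one_ne_zero (by norm_num) (by norm_num) u (by rw [hu]; norm_num)) (by decide)
  · exact iff_of_true (mk_eq_splitDiscriminantClassCM_two_of_coords_of_pos hR (by norm_num) (by norm_num)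
      disc_not_sq_three_one 27 5 1 5 3 1 one_ne_zero (by norm_num) (by norm_num) u (by rw [hu]; norm_num)) (by decide)
  · exact iff_of_true (mk_eq_splitDiscriminantClassCM_two_of_coords_of_pos hR (by norm_num) (by norm_num)
      disc_not_sq_three_one 28 6 2 2 2 1 one_ne_zero (by norm_num) (by norm_num) u (by rw [hu]; norm_num)) (by decide)
  · exact iff_of_true (mk_eq_splitDiscriminantClassCM_two_of_coords_of_pos hR (by norm_num) (by norm_num)
      disc_not_sq_three_one 29 5 0 4 2 1 one_ne_zero (by norm_num) (by norm_num) u (by rw [hu]; norm_num)) (by decide)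
  · exact iff_of_true (mk_eq_splitDiscriminantClassCM_two_of_coords_of_pos hR (by norm_num) (by norm_num)
      disc_not_sq_three_one 30 5 0 4 1 1 one_ne_zero (by norm_num) (by norm_num) u (by rw [hu]; norm_num)) (by decide)
  · exact iff_of_false (sqrtNeg1Sqrt5_mk_thirtyOne_mul_ne_splitDiscriminantClassCM hR 1 (by norm_num) u
      (by rw [hu]; norm_num)) (by decide)
  · exact iff_of_true (mk_eq_splitDiscriminantClassCM_two_of_coords_of_pos hR (by norm_num) (by norm_num)
      disc_not_sq_three_one 32 4 0 8 4 1 one_ne_zero (by norm_num) (by norm_num) u (by rw [hu]; norm_num)) (by decide)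
  · exact iff_of_false (sqrtNeg1Sqrt5_mk_eleven_mul_ne_splitDiscriminantClassCM hR 3 (by norm_num) u
      (by rw [hu]; norm_num)) (by decide)
  · exact iff_of_true (mk_eq_splitDiscriminantClassCM_two_of_coords_of_pos hR (by norm_num) (by norm_num)
      disc_not_sq_three_one 34 5 0 6 3 1 one_ne_zero (by norm_num) (by norm_num) u (by rw [hu]; norm_num)) (by decide)
  · exact iff_of_true (mk_eq_splitDiscriminantClassCM_two_of_coords_of_pos hR (by norm_num) (by norm_num)
      disc_not_sq_three_one 35 6 1 3 0 1 one_ne_zero (by norm_num) (by norm_num) u (by rw [hu]; norm_num)) (by decide)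
  · exact iff_of_true (mk_eq_splitDiscriminantClassCM_two_of_coords_of_pos hR (by norm_num) (by norm_num)
      disc_not_sq_three_one 36 6 0 0 0 1 one_ne_zero (by norm_num) (by norm_num) u (by rw [hu]; norm_num)) (by decide)
  · exact iff_of_true (mk_eq_splitDiscriminantClassCM_two_of_coords_of_pos hR (by norm_num) (by norm_num)
      disc_not_sq_three_one 37 6 0 2 1 1 one_ne_zero (by norm_num) (by norm_num) u (by rw [hu]; norm_num)) (by decide)
  · exact iff_of_false (sqrtNeg1Sqrt5_mk_nineteen_mul_ne_splitDiscriminantClassCM hR 2 (by norm_num) u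
      (by rw [hu]; norm_num)) (by decide)
  · exact iff_of_true (mk_eq_splitDiscriminantClassCM_two_of_coords_of_pos hR (by norm_num) (by norm_num)
      disc_not_sq_three_one 39 7 5 7 3 1 one_ne_zero (by norm_num) (by norm_num) u (by rw [hu]; norm_num)) (by decide)
  · exact iff_of_true (mk_eq_splitDiscriminantClassCM_two_of_coords_of_pos hR (by norm_num) (by norm_num)
      disc_not_sq_three_one 40 6 0 4 2 1 one_ne_zero (by norm_num) (by norm_num) u (by rw [hu]; norm_num)) (by decide)

end SqrtNeg1Sqrt5

end Summit.HodgeConjecture.HodgeConjecture.Ring2.WeilCoverageCM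

end
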